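import Literature.NumberTheory.ComplexMultiplication.CMOrderBassCharacterization
import HarnessLib

/-!
# `gens(S)`, the types of the over-orders and `gens_S(𝒪_K/S)` (MARSEGLIA 2024 THEOREM 4.7)

[cite: Marseglia2024CMType, §4 Thm. 4.7, Cor. 4.4, Prop. 4.5 and Lemma 4.2, pp. 10–11]
[cite: Greither1982TwoGenerator, §1 Lemma 1.3, p. 267; §2 Thm. 2.1, p. 267]

MARSEGLIA 2024 THEOREM 4.7: «Let `S` be a non-maximal order, `𝒮` be the set of overorders `T` of `S`, and `d` be a
positive integer. Then the following are equivalent: (i) `1 + max_{T ∈ 𝒮} type(T) = d`. (ii)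
`max_{T ∈ 𝒮} max{dim_{T/𝔓} (𝔓:𝔓)/𝔓 : 𝔓 a prime of T} = d`. (iii) `gens_S(𝒪_K/S) = d − 1`. (iv)
`max_{T ∈ 𝒮} max{dim_{T/𝔓} 𝒪_K/𝔓𝒪_K : 𝔓 a prime of T} = d`. (v) `max_{T ∈ 𝒮} gens(T) = d`. (vi) `gens(S) = d`.»

For the orders `S = endOrder (M_μ)` of a number field `K` (`μ` a `ℚ`-basis; the maximal order is the fractional
ideal `M` with `↑M = 𝒪_K`; over-orders are presented as `T = endOrder (M_ν) ⊇ S`; `gens_S(I) = spanFinrank ↑I`,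
`gens(S) = ⨆_{I ≠ 0} gens_S(I)`, `type(T) = ⨆_𝔔 dim_{T/𝔔} Tᵗ/𝔔Tᵗ`) this file proves the parts of the theorem
whose printed proof does not pass through LEMMA 4.3 `gens(S) ≤ max{2, gens_S(𝒪_K)}` in its general form
(GREITHER's THEOREM 2.1 «`v(R) = e(R) = [S/mS : R/m]`», resting on SALLY's multiplicity bound `v(I) ≤ e(R)`; the
tree has it under binary branching only, `CMOrderIdealGeneratorsMaximalOrderBound`):

* §1 «for every `T ∈ 𝒮`, every fractional `T`-ideal `I` is also a fractional `S`-ideal. So we have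
  `gens_T(I) ≤ gens_S(I)`. Hence `gens(S) = max_{T ∈ 𝒮} gens(T)`» ((v) = (vi)):
  `iSup_spanFinrank_coe_le_iSup_spanFinrank_coe_of_le`.
* §2 «`type(T) + 1 = max gens_T((𝔓:𝔓))` which is bounded from above by `gens(T)` … `gens(T) ≤ gens(S)`, which
  gives us `type(T) + 1 ≤ gens(S)`» — for EVERY over-order `T` of a non-maximal `S` (the half of (i) ⟺ (vi) that
  is unconditional; `type(𝒪_K) = 1` and `gens(S) ≥ 2` cover `T = 𝒪_K`):
  **`iSup_finrank_traceDual_quotient_add_one_le_iSup_spanFinrank_of_le`**.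
* §3 (iii): the `S`-module `𝒪_K/S` is `↥↑M ⧸ (S·1 ∩ ↑M)`, spelled `↥↑M ⧸ (1 : Submodule S K).comap (↑M).subtype`;
  **`spanFinrank_top_quotient_add_one_eq_iSup_finrank_quotient_smul_top`:
  `gens_S(𝒪_K/S) + 1 = max_𝔭 dim_{S/𝔭} 𝒪_K/𝔭𝒪_K`** (unconditional; `≤`: LEMMA 4.2's construction with the
  prescribed first generator `b₁ = 1`, `CMOrderBassCharacterization` §1 — GREITHER LEMMA 1.3 «As `0 ≠ 1̄ ∈ S/mS`, we
  get that `S_m/R_m` is `(n−1)`-generated»; `≥`: lifts of generators of `𝒪_K/S` together with `1` generate `𝒪_K`, and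
  `dim 𝒪_K/𝔭𝒪_K ≤ gens_S(𝒪_K)`.  MARSEGLIA's own route is Nakayama for the finite-length module `𝒪_K/S` and the
  exact sequence (4.4) `0 → (S + 𝔭𝒪_K)/𝔭𝒪_K → 𝒪_K/𝔭𝒪_K → 𝒪_K/(S + 𝔭𝒪_K) → 0`),
  `spanFinrank_top_quotient_add_one_eq_spanFinrank_coe` (`= gens_S(𝒪_K)` for `S ≠ 𝒪_K`, COR. 4.4's second equality),
  `spanFinrank_top_quotient_le_one_iff_exists_coe_eq_span_pair` (the two spellings of «`𝒪_K/S` is cyclic» agree).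
* §4 under binary branching at the non-invertible primes (where the tree has COROLLARY 4.4 in full):
  `iSup_spanFinrank_coe_eq_spanFinrank_top_quotient_add_one_of_binaryBranching` ((iii) ⟺ (vi):
  `gens(S) = gens_S(𝒪_K/S) + 1`) and **`forall_le_and_exists_eq_iSup_spanFinrank_of_binaryBranching`** ((i) ⟺ (vi):
  `gens(S) = 1 + max_{T ∈ 𝒮} type(T)`, as «`≤` for every `T`, `=` for some `T = S + 𝔭𝒪_K`»).
-/

noncomputable section

open scoped nonZeroDivisors NumberField
open NumberField Module FractionalIdeal
open Submodule (traceDual)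

namespace Literature.NumberTheory.ComplexMultiplication

namespace CMTypeLattice

section Overorders

variable {K : Type} [Field K] [NumberField K]
variable {ι : Type} [Fintype ι] [DecidableEq ι] (μ : Basis ι ℚ K) [Nonempty ι]
variable [IsFractionRing (endOrder (Algebra.leftMulMatrix μ)) K]

/-! ## §1 `gens(T) ≤ gens(S)` for over-orders -/

omit [IsFractionRing (endOrder (Algebra.leftMulMatrix μ)) K] in
/-- **MARSEGLIA 2024 THEOREM 4.7 (proof), «`gens(T) ≤ gens(S)`» for every over-order `T = endOrder (M_ν) ⊇ S`**
(every fractional `T`-ideal is a fractional `S`-ideal and `gens_T(I) ≤ gens_S(I)`); hence «`gens(S) =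
max_{T ∈ 𝒮} gens(T)`», (v) = (vi). [cite: Marseglia2024CMType, §4 Thm. 4.7 (proof, (iv) ⟺ (v) ⟺ (vi)), p. 11] -/
theorem iSup_spanFinrank_coe_le_iSup_spanFinrank_coe_of_le {ν : Basis ι ℚ K}
    [IsFractionRing (endOrder (Algebra.leftMulMatrix ν)) K]
    (hST : endOrder (Algebra.leftMulMatrix μ) ≤ endOrder (Algebra.leftMulMatrix ν)) :
    ⨆ I' : {I' : FractionalIdeal (endOrder (Algebra.leftMulMatrix ν))⁰ K // I' ≠ 0},
        ((I' : FractionalIdeal (endOrder (Algebra.leftMulMatrix ν))⁰ K) :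
          Submodule (endOrder (Algebra.leftMulMatrix ν)) K).spanFinrank ≤
      ⨆ I : {I : FractionalIdeal (endOrder (Algebra.leftMulMatrix μ))⁰ K // I ≠ 0},
        ((I : FractionalIdeal (endOrder (Algebra.leftMulMatrix μ))⁰ K) :
          Submodule (endOrder (Algebra.leftMulMatrix μ)) K).spanFinrank := by
  haveI : Nonempty {I' : FractionalIdeal (endOrder (Algebra.leftMulMatrix ν))⁰ K // I' ≠ 0} := ⟨⟨1, one_ne_zero⟩⟩
  exact ciSup_le fun I' ↦ by
    obtain ⟨I, hI0, hI⟩ := exists_ne_zero_coe_eq_coe_of_le μ hST I'.2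
    exact (spanFinrank_coe_le_spanFinrank_coe_of_le μ hST hI).trans (spanFinrank_coe_le_iSup μ hI0)

/-! ## §2 `type(T) + 1 ≤ gens(S)` for every over-order `T` -/

/-- **MARSEGLIA 2024 THEOREM 4.7, (i) versus (vi) for all over-orders: `type(T) + 1 ≤ gens(S)` for every over-order
`T = endOrder (M_ν) ⊇ S` of a non-maximal order `S`** («`type(T) + 1 = max{gens_T((𝔓:𝔓))}` which is bounded from
above by `gens(T)` … `gens(T) ≤ gens(S)`»; for `T = 𝒪_K`, `type(T) = 1` and `gens(S) ≥ 2`).  The reverse inequality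
`gens(S) ≤ 1 + max_T type(T)` is §4 (binary branching). [cite: Marseglia2024CMType, §4 Thm. 4.7 ((i) ⟺ (vi), proof),
p. 11; §1 Main Theorem 2, p. 3] -/
theorem iSup_finrank_traceDual_quotient_add_one_le_iSup_spanFinrank_of_le
    (hS : ∃ a : 𝓞 K, (a : K) ∉ endOrder (Algebra.leftMulMatrix μ))
    {ν : Basis ι ℚ K} (hST : endOrder (Algebra.leftMulMatrix μ) ≤ endOrder (Algebra.leftMulMatrix ν))
    [IsFractionRing (endOrder (Algebra.leftMulMatrix ν)) K]
    {T' : FractionalIdeal (endOrder (Algebra.leftMulMatrix ν))⁰ K}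
    (hT' : (T' : Submodule (endOrder (Algebra.leftMulMatrix ν)) K) =
      traceDual ℤ ℚ ((1 : FractionalIdeal (endOrder (Algebra.leftMulMatrix ν))⁰ K) :
        Submodule (endOrder (Algebra.leftMulMatrix ν)) K)) :
    (⨆ 𝔔 : MaximalSpectrum (endOrder (Algebra.leftMulMatrix ν)),
        Module.finrank (endOrder (Algebra.leftMulMatrix ν) ⧸ 𝔔.asIdeal)
          ((T' : Submodule (endOrder (Algebra.leftMulMatrix ν)) K) ⧸
            (𝔔.asIdeal • ⊤ : Submodule (endOrder (Algebra.leftMulMatrix ν))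
              (T' : Submodule (endOrder (Algebra.leftMulMatrix ν)) K)))) + 1 ≤
      ⨆ I : {I : FractionalIdeal (endOrder (Algebra.leftMulMatrix μ))⁰ K // I ≠ 0},
        ((I : FractionalIdeal (endOrder (Algebra.leftMulMatrix μ))⁰ K) :
          Submodule (endOrder (Algebra.leftMulMatrix μ)) K).spanFinrank := by
  by_cases hS' : ∃ a : 𝓞 K, (a : K) ∉ endOrder (Algebra.leftMulMatrix ν)
  · exact (iSup_finrank_traceDual_quotient_add_one_le_iSup_spanFinrank ν hT' hS').trans
      (iSup_spanFinrank_coe_le_iSup_spanFinrank_coe_of_le μ hST)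
  · push Not at hS'
    rw [iSup_finrank_traceDual_quotient_eq_one_of_forall_mem ν hT' hS']
    exact two_le_iSup_spanFinrank μ hS

/-! ## §3 (iii): `gens_S(𝒪_K/S) + 1 = max_𝔭 dim_{S/𝔭} 𝒪_K/𝔭𝒪_K = gens_S(𝒪_K)` -/

/-- **MARSEGLIA 2024 THEOREM 4.7, (iii) ⟺ (iv) at `T = S`: `gens_S(𝒪_K/S) + 1 = max_𝔭 dim_{S/𝔭} 𝒪_K/𝔭𝒪_K`** for the
`S`-module `𝒪_K/S = ↥↑M ⧸ (S·1 ∩ ↑M)` («By Nakayama's Lemma and an argument similar to the proof of Lemma 4.2, we have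
`gens_S(M) = max dim_{S/𝔭} M/𝔭M` … `dim 𝒪_K/𝔭𝒪_K = dim M/𝔭M + 1`»; here: `≤` by LEMMA 4.2's construction with first
generator `1` — GREITHER LEMMA 1.3 «As `0 ≠ 1̄ ∈ S/mS`, we get that `S_m/R_m ≅ (S/R)_m` is `(n − 1)`-generated» —,
`≥` because lifts of generators of `𝒪_K/S` together with `1` generate `𝒪_K` and `dim 𝒪_K/𝔭𝒪_K ≤ gens_S(𝒪_K)`).
[cite: Marseglia2024CMType, §4 Thm. 4.7 ((iii), proof with (4.3)–(4.4)), p. 11] [cite: Greither1982TwoGenerator, §1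
Lemma 1.3 (proof), p. 267] -/
theorem spanFinrank_top_quotient_add_one_eq_iSup_finrank_quotient_smul_top
    {M : FractionalIdeal (endOrder (Algebra.leftMulMatrix μ))⁰ K}
    (hMO : (M : Set K) = (algebraMap (𝓞 K) K).range) :
    (⊤ : Submodule (endOrder (Algebra.leftMulMatrix μ))
        ((M : Submodule (endOrder (Algebra.leftMulMatrix μ)) K) ⧸
          (1 : Submodule (endOrder (Algebra.leftMulMatrix μ)) K).comap
            (M : Submodule (endOrder (Algebra.leftMulMatrix μ)) K).subtype)).spanFinrank + 1 =
      ⨆ 𝔭 : MaximalSpectrum (endOrder (Algebra.leftMulMatrix μ)),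
        Module.finrank (endOrder (Algebra.leftMulMatrix μ) ⧸ 𝔭.asIdeal)
          ((M : Submodule (endOrder (Algebra.leftMulMatrix μ)) K) ⧸
            (𝔭.asIdeal • ⊤ : Submodule (endOrder (Algebra.leftMulMatrix μ))
              (M : Submodule (endOrder (Algebra.leftMulMatrix μ)) K))) := by
  classical
  haveI := isNoetherianRing_endOrder (Algebra.leftMulMatrix μ)
  haveI := dimensionLEOne_endOrder (Algebra.leftMulMatrix μ)
  haveI := nonempty_maximalSpectrum μ
  have hbdd := bddAbove_range_finrank_quotient_smul_top μ hMO
  obtain ⟨-, h1M⟩ := EndOrder.mul_self_le_and_one_mem_of_coe_eq_range hMO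
  have h1M' : (1 : K) ∈ (M : Submodule (endOrder (Algebra.leftMulMatrix μ)) K) := mem_coe.2 h1M
  have hM0 := ne_zero_of_coe_eq_range μ hMO
  have hfg : (M : Submodule (endOrder (Algebra.leftMulMatrix μ)) K).FG := fg_of_isNoetherianRing le_rfl M
  set N₁ : Submodule (endOrder (Algebra.leftMulMatrix μ)) (M : Submodule (endOrder (Algebra.leftMulMatrix μ)) K) :=
    (1 : Submodule (endOrder (Algebra.leftMulMatrix μ)) K).comap
      (M : Submodule (endOrder (Algebra.leftMulMatrix μ)) K).subtype with hN₁
  set d := ⨆ 𝔭 : MaximalSpectrum (endOrder (Algebra.leftMulMatrix μ)),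
    Module.finrank (endOrder (Algebra.leftMulMatrix μ) ⧸ 𝔭.asIdeal)
      ((M : Submodule (endOrder (Algebra.leftMulMatrix μ)) K) ⧸
        (𝔭.asIdeal • ⊤ : Submodule (endOrder (Algebra.leftMulMatrix μ))
          (M : Submodule (endOrder (Algebra.leftMulMatrix μ)) K))) with hd
  -- `d ≥ 1`
  obtain ⟨𝔭₀, h𝔭₀⟩ := exists_finrank_quotient_smul_top_eq_iSup μ hMO
  have hd1 : 1 ≤ d := by
    rw [hd, ← h𝔭₀]
    haveI := 𝔭₀.isMaximal
    exact NumberRing.finrank_quotient_smul_top_pos 𝔭₀.asIdeal hfg fun h ↦ hM0 (coeToSubmodule_eq_bot.1 h)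
  -- `≤`: LEMMA 4.2 with `b₁ = 1`, `n = d - 1`
  have h1 : ∀ 𝔭 : MaximalSpectrum (endOrder (Algebra.leftMulMatrix μ)),
      (1 : K) ∉ 𝔭.asIdeal • (M : Submodule (endOrder (Algebra.leftMulMatrix μ)) K) := fun 𝔭 h ↦
    one_not_mem_coeIdeal_mul μ hMO 𝔭.isMaximal.ne_top (by rwa [← NumberRing.coe_coeIdeal_mul, mem_coe] at h)
  obtain ⟨b, hbM, hMb⟩ :=
    NumberRing.exists_eq_span_insert_of_forall_finrank_quotient_le hM0 (n := d - 1) h1M h1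
      fun 𝔭 ↦ (le_ciSup hbdd 𝔭).trans le_tsub_add
  have hle : (⊤ : Submodule (endOrder (Algebra.leftMulMatrix μ))
      ((M : Submodule (endOrder (Algebra.leftMulMatrix μ)) K) ⧸ N₁)).spanFinrank ≤ d - 1 := by
    set b' : Fin (d - 1) → (M : Submodule (endOrder (Algebra.leftMulMatrix μ)) K) := fun j ↦ ⟨b j, hbM j⟩ with hb'
    have hcomp : ((M : Submodule (endOrder (Algebra.leftMulMatrix μ)) K).subtype ∘ b' : Fin (d - 1) → K) = b :=
      funext fun _ ↦ rfl
    -- `S·1 ∩ 𝒪_K + Σ S bⱼ = 𝒪_K`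
    have hsup : N₁ ⊔ Submodule.span (endOrder (Algebra.leftMulMatrix μ)) (Set.range b') = ⊤ := by
      refine eq_top_iff.2 fun x _ ↦ ?_
      have hx : (x : K) ∈ Submodule.span (endOrder (Algebra.leftMulMatrix μ)) (insert 1 (Set.range b)) :=
        hMb ▸ x.2
      rw [Submodule.span_insert, Submodule.mem_sup] at hx
      obtain ⟨y, hy, z, hz, hyz⟩ := hx
      have hyM : y ∈ (M : Submodule (endOrder (Algebra.leftMulMatrix μ)) K) := by
        obtain ⟨s, rfl⟩ := Submodule.mem_span_singleton.1 hy
        exact Submodule.smul_mem _ s h1M'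
      have hzM : z ∈ (M : Submodule (endOrder (Algebra.leftMulMatrix μ)) K) := by
        have hz' : z = x - y := by rw [← hyz]; ring
        rw [hz']
        exact Submodule.sub_mem _ x.2 hyM
      have hx' : x = ⟨y, hyM⟩ + ⟨z, hzM⟩ := Subtype.ext hyz.symm
      rw [hx']
      refine Submodule.add_mem_sup ?_ ?_
      · rw [hN₁, Submodule.mem_comap, Submodule.subtype_apply, Submodule.one_eq_span]
        exact hy
      · rw [← Submodule.comap_map_eq_of_injective (M : Submodule (endOrder (Algebra.leftMulMatrix μ)) K).injective_subtype
          (Submodule.span (endOrder (Algebra.leftMulMatrix μ)) (Set.range b')), Submodule.map_span, ← Set.range_comp,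
          hcomp, Submodule.mem_comap]
        exact hz
    have htop : (⊤ : Submodule (endOrder (Algebra.leftMulMatrix μ))
        ((M : Submodule (endOrder (Algebra.leftMulMatrix μ)) K) ⧸ N₁)) =
        Submodule.span (endOrder (Algebra.leftMulMatrix μ)) (Set.range (N₁.mkQ ∘ b')) := by
      rw [← Submodule.range_mkQ N₁, ← Submodule.map_top, ← hsup, Submodule.map_sup, Submodule.mkQ_map_self,
        bot_sup_eq, Submodule.map_span, ← Set.range_comp]
    rw [htop]
    refine (Submodule.spanFinrank_span_le_ncard_of_finite (Set.finite_range _)).trans ?_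
    rw [← Set.image_univ, ← Finset.coe_univ, ← Finset.coe_image, Set.ncard_coe_finset]
    exact Finset.card_image_le.trans (by simp)
  -- `≥`: lifts of generators of `𝒪_K/S`, with `1`, generate `𝒪_K`
  have hge : d ≤ (⊤ : Submodule (endOrder (Algebra.leftMulMatrix μ))
      ((M : Submodule (endOrder (Algebra.leftMulMatrix μ)) K) ⧸ N₁)).spanFinrank + 1 := by
    haveI : Module.Finite (endOrder (Algebra.leftMulMatrix μ)) (M : Submodule (endOrder (Algebra.leftMulMatrix μ)) K) :=
      Module.Finite.iff_fg.2 hfg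
    obtain ⟨G, hGcard, hGspan⟩ := Submodule.FG.exists_span_finset_card_eq_spanFinrank
      (Module.Finite.fg_top : (⊤ : Submodule (endOrder (Algebra.leftMulMatrix μ))
        ((M : Submodule (endOrder (Algebra.leftMulMatrix μ)) K) ⧸ N₁)).FG)
    choose c hc using fun g : (M : Submodule (endOrder (Algebra.leftMulMatrix μ)) K) ⧸ N₁ ↦
      Submodule.Quotient.mk_surjective N₁ g
    set s : Set K := insert 1 ((fun g ↦ ((c g : (M : Submodule (endOrder (Algebra.leftMulMatrix μ)) K)) : K)) ''
      (G : Set ((M : Submodule (endOrder (Algebra.leftMulMatrix μ)) K) ⧸ N₁))) with hs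
    have hsM : s ⊆ (M : Submodule (endOrder (Algebra.leftMulMatrix μ)) K) := by
      rintro x (rfl | ⟨g, -, rfl⟩)
      · exact h1M'
      · exact (c g).2
    have hMs : (M : Submodule (endOrder (Algebra.leftMulMatrix μ)) K) =
        Submodule.span (endOrder (Algebra.leftMulMatrix μ)) s := by
      refine le_antisymm (fun x hx ↦ ?_) (Submodule.span_le.2 hsM)
      have h1s : Submodule.span (endOrder (Algebra.leftMulMatrix μ)) {(1 : K)} ≤
          Submodule.span (endOrder (Algebra.leftMulMatrix μ)) s :=
        Submodule.span_mono (Set.singleton_subset_iff.2 (Set.mem_insert _ _))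
      have hxG : N₁.mkQ ⟨x, hx⟩ ∈ Submodule.map N₁.mkQ (Submodule.span (endOrder (Algebra.leftMulMatrix μ))
          (c '' (G : Set ((M : Submodule (endOrder (Algebra.leftMulMatrix μ)) K) ⧸ N₁)))) := by
        have h : N₁.mkQ ⟨x, hx⟩ ∈ Submodule.span (endOrder (Algebra.leftMulMatrix μ))
            (G : Set ((M : Submodule (endOrder (Algebra.leftMulMatrix μ)) K) ⧸ N₁)) := hGspan ▸ Submodule.mem_top
        refine (Submodule.span_le.2 fun g hg ↦ ?_) h
        rw [SetLike.mem_coe, ← hc g]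
        exact Submodule.mem_map_of_mem (Submodule.subset_span (Set.mem_image_of_mem c hg))
      obtain ⟨w, hw, hwx⟩ := Submodule.mem_map.1 hxG
      have hxw : ((⟨x, hx⟩ : (M : Submodule (endOrder (Algebra.leftMulMatrix μ)) K)) - w : K) ∈
          Submodule.span (endOrder (Algebra.leftMulMatrix μ)) s := by
        refine h1s ?_
        rw [← Submodule.one_eq_span]
        exact Submodule.mem_comap.1 ((Submodule.Quotient.eq N₁).1 hwx.symm)
      have hwS : (w : K) ∈ Submodule.span (endOrder (Algebra.leftMulMatrix μ)) s := by
        have h := Submodule.mem_map_of_mem (f := (M : Submodule (endOrder (Algebra.leftMulMatrix μ)) K).subtype) hw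
        rw [Submodule.map_span, Submodule.coe_subtype, Set.image_image] at h
        exact Submodule.span_mono (Set.subset_insert _ _) h
      have hx' : x = (((⟨x, hx⟩ : (M : Submodule (endOrder (Algebra.leftMulMatrix μ)) K)) - w :
          (M : Submodule (endOrder (Algebra.leftMulMatrix μ)) K)) : K) + (w : K) := by
        simp only [Submodule.coe_sub, sub_add_cancel]
      rw [hx']
      exact Submodule.add_mem _ hxw hwS
    have hcard : s.ncard ≤ G.card + 1 := by
      refine (Set.ncard_insert_le _ _).trans ?_
      rw [← Set.ncard_coe_finset]
      exact Nat.add_le_add_right (Set.ncard_image_le G.finite_toSet) 1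
    refine ciSup_le fun 𝔭 ↦ ?_
    haveI := 𝔭.isMaximal
    calc Module.finrank (endOrder (Algebra.leftMulMatrix μ) ⧸ 𝔭.asIdeal)
          ((M : Submodule (endOrder (Algebra.leftMulMatrix μ)) K) ⧸
            (𝔭.asIdeal • ⊤ : Submodule (endOrder (Algebra.leftMulMatrix μ))
              (M : Submodule (endOrder (Algebra.leftMulMatrix μ)) K)))
        ≤ (M : Submodule (endOrder (Algebra.leftMulMatrix μ)) K).spanFinrank :=
          EndOrder.finrank_quotient_smul_top_le_spanFinrank M (asIdeal_ne_bot μ 𝔭)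
      _ ≤ s.ncard := by
          rw [hMs]
          exact Submodule.spanFinrank_span_le_ncard_of_finite ((G.finite_toSet.image _).insert 1)
      _ ≤ G.card + 1 := hcard
      _ = _ := by rw [hGcard]
  omega

/-- **COROLLARY 4.4 / THEOREM 4.7 (iii) ⟺ (iv) at `T = S`, for a non-maximal order: `gens_S(𝒪_K/S) + 1 = gens_S(𝒪_K)`**
(the previous theorem and `gens_S(𝒪_K) = max_𝔭 dim_{S/𝔭} 𝒪_K/𝔭𝒪_K`, `CMOrderMaximalOrderGeneratorsCount`).
[cite: Marseglia2024CMType, §4 Thm. 4.7 (iii) and Cor. 4.4, pp. 10–11] [cite: Greither1982TwoGenerator, §1 Lemma 1.3,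
p. 267] -/
theorem spanFinrank_top_quotient_add_one_eq_spanFinrank_coe
    {M : FractionalIdeal (endOrder (Algebra.leftMulMatrix μ))⁰ K}
    (hMO : (M : Set K) = (algebraMap (𝓞 K) K).range)
    (hS : ∃ a : 𝓞 K, (a : K) ∉ endOrder (Algebra.leftMulMatrix μ)) :
    (⊤ : Submodule (endOrder (Algebra.leftMulMatrix μ))
        ((M : Submodule (endOrder (Algebra.leftMulMatrix μ)) K) ⧸
          (1 : Submodule (endOrder (Algebra.leftMulMatrix μ)) K).comap
            (M : Submodule (endOrder (Algebra.leftMulMatrix μ)) K).subtype)).spanFinrank + 1 =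
      (M : Submodule (endOrder (Algebra.leftMulMatrix μ)) K).spanFinrank := by
  rw [spanFinrank_top_quotient_add_one_eq_iSup_finrank_quotient_smul_top μ hMO,
    spanFinrank_coe_eq_iSup_finrank_quotient_smul_top μ hMO hS]

/-- **The two spellings of «the `S`-module `𝒪_K/S` is cyclic» agree: `gens_S(𝒪_K/S) ≤ 1 ⟺ 𝒪_K = S + Sω` for some
`ω`** (both say `max_𝔭 dim_{S/𝔭} 𝒪_K/𝔭𝒪_K ≤ 2`). [cite: Marseglia2024CMType, §4 Prop. 4.6 (iv) and Thm. 4.7 (iii)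
with `d = 2`, pp. 10–11] [cite: Greither1982TwoGenerator, §1 Prop. 1.1 and Lemma 1.3 («`R` is a Q-ring iff `S/R` is
cyclic»), pp. 266–267] -/
theorem spanFinrank_top_quotient_le_one_iff_exists_coe_eq_span_pair
    {M : FractionalIdeal (endOrder (Algebra.leftMulMatrix μ))⁰ K}
    (hMO : (M : Set K) = (algebraMap (𝓞 K) K).range) :
    (⊤ : Submodule (endOrder (Algebra.leftMulMatrix μ))
        ((M : Submodule (endOrder (Algebra.leftMulMatrix μ)) K) ⧸
          (1 : Submodule (endOrder (Algebra.leftMulMatrix μ)) K).comap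
            (M : Submodule (endOrder (Algebra.leftMulMatrix μ)) K).subtype)).spanFinrank ≤ 1 ↔
      ∃ ω ∈ M, (M : Submodule (endOrder (Algebra.leftMulMatrix μ)) K) =
        Submodule.span (endOrder (Algebra.leftMulMatrix μ)) {1, ω} := by
  haveI := nonempty_maximalSpectrum μ
  have hbdd := bddAbove_range_finrank_quotient_smul_top μ hMO
  have h := spanFinrank_top_quotient_add_one_eq_iSup_finrank_quotient_smul_top μ hMO
  constructor
  · intro h1
    refine exists_coe_eq_span_pair_of_forall_finrank_quotient_le_two μ hMO fun 𝔭 ↦ (le_ciSup hbdd 𝔭).trans ?_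
    rw [← h]
    omega
  · rintro ⟨ω, -, hcyc⟩
    have h2 : (⨆ 𝔭 : MaximalSpectrum (endOrder (Algebra.leftMulMatrix μ)),
        Module.finrank (endOrder (Algebra.leftMulMatrix μ) ⧸ 𝔭.asIdeal)
          ((M : Submodule (endOrder (Algebra.leftMulMatrix μ)) K) ⧸
            (𝔭.asIdeal • ⊤ : Submodule (endOrder (Algebra.leftMulMatrix μ))
              (M : Submodule (endOrder (Algebra.leftMulMatrix μ)) K)))) ≤ 2 :=
      ciSup_le fun 𝔭 ↦ by
        haveI := 𝔭.isMaximal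
        exact finrank_quotient_smul_top_le_two_of_coe_eq_span_pair μ hcyc (asIdeal_ne_bot μ 𝔭)
    omega

/-! ## §4 THEOREM 4.7 (i) ⟺ (iii) ⟺ (vi) under binary branching -/

/-- **MARSEGLIA 2024 THEOREM 4.7, (iii) ⟺ (vi): `gens(S) = gens_S(𝒪_K/S) + 1`** for a non-maximal order `S` whose
non-invertible primes lie under at most two primes of `𝒪_K` (where the tree has COROLLARY 4.4
`gens(S) = gens_S(𝒪_K)`, `CMOrderIdealGeneratorsMaximalOrderBound`). [cite: Marseglia2024CMType, §4 Thm. 4.7 ((iii) ⟺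
(vi) «`gens(S) = gens_S(M) + 1`»), p. 11] [cite: Greither1982TwoGenerator, §2 Thm. 2.1 and §1 Lemma 1.3, p. 267] -/
theorem iSup_spanFinrank_coe_eq_spanFinrank_top_quotient_add_one_of_binaryBranching
    {M : FractionalIdeal (endOrder (Algebra.leftMulMatrix μ))⁰ K}
    (hMO : (M : Set K) = (algebraMap (𝓞 K) K).range)
    (hS : ∃ a : 𝓞 K, (a : K) ∉ endOrder (Algebra.leftMulMatrix μ))
    (h3 : ∀ 𝔭 : MaximalSpectrum (endOrder (Algebra.leftMulMatrix μ)),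
      ¬ IsUnit (𝔭.asIdeal : FractionalIdeal (endOrder (Algebra.leftMulMatrix μ))⁰ K) →
      ∀ Q₁ Q₂ Q₃ : Ideal (𝓞 K), Q₁.IsMaximal → Q₂.IsMaximal → Q₃.IsMaximal →
        𝔭.asIdeal.map (EndOrder.toRingOfIntegers (Algebra.leftMulMatrix μ)) ≤ Q₁ →
        𝔭.asIdeal.map (EndOrder.toRingOfIntegers (Algebra.leftMulMatrix μ)) ≤ Q₂ →
        𝔭.asIdeal.map (EndOrder.toRingOfIntegers (Algebra.leftMulMatrix μ)) ≤ Q₃ → Q₁ = Q₂ ∨ Q₁ = Q₃ ∨ Q₂ = Q₃) :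
    ⨆ I : {I : FractionalIdeal (endOrder (Algebra.leftMulMatrix μ))⁰ K // I ≠ 0},
        ((I : FractionalIdeal (endOrder (Algebra.leftMulMatrix μ))⁰ K) :
          Submodule (endOrder (Algebra.leftMulMatrix μ)) K).spanFinrank =
      (⊤ : Submodule (endOrder (Algebra.leftMulMatrix μ))
        ((M : Submodule (endOrder (Algebra.leftMulMatrix μ)) K) ⧸
          (1 : Submodule (endOrder (Algebra.leftMulMatrix μ)) K).comap
            (M : Submodule (endOrder (Algebra.leftMulMatrix μ)) K).subtype)).spanFinrank + 1 := by
  rw [iSup_spanFinrank_coe_eq_spanFinrank_coe_of_binaryBranching μ hMO hS h3,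
    spanFinrank_top_quotient_add_one_eq_spanFinrank_coe μ hMO hS]

/-- **MARSEGLIA 2024 THEOREM 4.7, (i) ⟺ (vi): `gens(S) = 1 + max_{T ∈ 𝒮} type(T)`** for a non-maximal order `S`
whose non-invertible primes lie under at most two primes of `𝒪_K` — as «`type(T) + 1 ≤ gens(S)` for every
over-order `T = endOrder (M_ν) ⊇ S` (§2, unconditional), with equality for some over-order (`T = S + 𝔭𝒪_K` at a
suitable non-invertible `𝔭`, PROPOSITION 4.5 and COROLLARY 4.4)». [cite: Marseglia2024CMType, §4 Thm. 4.7 ((i) ⟺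
(vi), proof via Prop. 4.5 «`gens(S) = 1 + max{type(S + 𝔭𝒪_K)}`»), p. 11] -/
theorem forall_le_and_exists_eq_iSup_spanFinrank_of_binaryBranching
    {M : FractionalIdeal (endOrder (Algebra.leftMulMatrix μ))⁰ K}
    (hMO : (M : Set K) = (algebraMap (𝓞 K) K).range)
    (hS : ∃ a : 𝓞 K, (a : K) ∉ endOrder (Algebra.leftMulMatrix μ))
    (h3 : ∀ 𝔭 : MaximalSpectrum (endOrder (Algebra.leftMulMatrix μ)),
      ¬ IsUnit (𝔭.asIdeal : FractionalIdeal (endOrder (Algebra.leftMulMatrix μ))⁰ K) →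
      ∀ Q₁ Q₂ Q₃ : Ideal (𝓞 K), Q₁.IsMaximal → Q₂.IsMaximal → Q₃.IsMaximal →
        𝔭.asIdeal.map (EndOrder.toRingOfIntegers (Algebra.leftMulMatrix μ)) ≤ Q₁ →
        𝔭.asIdeal.map (EndOrder.toRingOfIntegers (Algebra.leftMulMatrix μ)) ≤ Q₂ →
        𝔭.asIdeal.map (EndOrder.toRingOfIntegers (Algebra.leftMulMatrix μ)) ≤ Q₃ → Q₁ = Q₂ ∨ Q₁ = Q₃ ∨ Q₂ = Q₃) :
    (∀ ν : Basis ι ℚ K, endOrder (Algebra.leftMulMatrix μ) ≤ endOrder (Algebra.leftMulMatrix ν) →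
      ∀ T' : FractionalIdeal (endOrder (Algebra.leftMulMatrix ν))⁰ K,
        (T' : Submodule (endOrder (Algebra.leftMulMatrix ν)) K) =
          traceDual ℤ ℚ ((1 : FractionalIdeal (endOrder (Algebra.leftMulMatrix ν))⁰ K) :
            Submodule (endOrder (Algebra.leftMulMatrix ν)) K) →
        (⨆ 𝔔 : MaximalSpectrum (endOrder (Algebra.leftMulMatrix ν)),
            Module.finrank (endOrder (Algebra.leftMulMatrix ν) ⧸ 𝔔.asIdeal)
              ((T' : Submodule (endOrder (Algebra.leftMulMatrix ν)) K) ⧸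
                (𝔔.asIdeal • ⊤ : Submodule (endOrder (Algebra.leftMulMatrix ν))
                  (T' : Submodule (endOrder (Algebra.leftMulMatrix ν)) K)))) + 1 ≤
          ⨆ I : {I : FractionalIdeal (endOrder (Algebra.leftMulMatrix μ))⁰ K // I ≠ 0},
            ((I : FractionalIdeal (endOrder (Algebra.leftMulMatrix μ))⁰ K) :
              Submodule (endOrder (Algebra.leftMulMatrix μ)) K).spanFinrank) ∧
    ∃ ν : Basis ι ℚ K, endOrder (Algebra.leftMulMatrix μ) ≤ endOrder (Algebra.leftMulMatrix ν) ∧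
      ∀ T' : FractionalIdeal (endOrder (Algebra.leftMulMatrix ν))⁰ K,
        (T' : Submodule (endOrder (Algebra.leftMulMatrix ν)) K) =
          traceDual ℤ ℚ ((1 : FractionalIdeal (endOrder (Algebra.leftMulMatrix ν))⁰ K) :
            Submodule (endOrder (Algebra.leftMulMatrix ν)) K) →
        (⨆ 𝔔 : MaximalSpectrum (endOrder (Algebra.leftMulMatrix ν)),
            Module.finrank (endOrder (Algebra.leftMulMatrix ν) ⧸ 𝔔.asIdeal)
              ((T' : Submodule (endOrder (Algebra.leftMulMatrix ν)) K) ⧸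
                (𝔔.asIdeal • ⊤ : Submodule (endOrder (Algebra.leftMulMatrix ν))
                  (T' : Submodule (endOrder (Algebra.leftMulMatrix ν)) K)))) + 1 =
          ⨆ I : {I : FractionalIdeal (endOrder (Algebra.leftMulMatrix μ))⁰ K // I ≠ 0},
            ((I : FractionalIdeal (endOrder (Algebra.leftMulMatrix μ))⁰ K) :
              Submodule (endOrder (Algebra.leftMulMatrix μ)) K).spanFinrank := by
  refine ⟨fun ν hST T' hT' ↦ ?_, ?_⟩
  · haveI := isFractionRing_endOrder (Algebra.leftMulMatrix ν)
    exact iSup_finrank_traceDual_quotient_add_one_le_iSup_spanFinrank_of_le μ hS hST hT'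
  · obtain ⟨𝔭, -, h𝔭⟩ := exists_not_isUnit_forall_iSup_add_one_eq_iSup_spanFinrank_of_binaryBranching μ hMO hS h3
    obtain ⟨ν, hν⟩ := exists_basis_mem_endOrder_iff_exists_add μ hMO 𝔭.asIdeal
    exact ⟨ν, endOrder_le_endOrder_of_mem_iff μ ν hν, h𝔭 ν hν⟩

end Overorders

end CMTypeLattice

end Literature.NumberTheory.ComplexMultiplication
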